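import Summits.CriticalPhenomena.PercolationContinuityZ3.Theorems.PercNearOneGluingNoHeavyConstsClusterSquareApexHubLinked
import HarnessLib

/-!
# Outerplanar graph plus one apex: no double linkage with the APEX as a terminal or as the root (sector condition)

builds on p205010 (kernel theorem, internal audit signed; external expert review pending)

PAPER-2 track "percolation constants", part (ii), seat `prim-consts-1`, gen 21 (lane index
`run/shared/lean/prim/consts/CONSTANTS.md`, row A19; memo `FROM-prim-consts-1-g21-APEX-TERMINAL.md`).
Support file for the crux `NoHeavyLowerTail` (stmt-CriticalPhenomena-4575; `--supports`).  Theorems only; no definitions, no sorries.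

THE CLASS (as in `…ConstsClusterSquareApex.lean`).  `H` on `Fin n` with an APEX `h`; the other (rim) vertices carry positions
`pos u : Fin m`, injective on the rim; (R) rim edges pairwise non-crossing; (F) no rim edge separates two apex-neighbours — an
outerplanar rim graph with one extra vertex drawn inside one of its faces.  For two rim vertices `a, b` the SECTOR CONDITION (S)
says: no two apex-neighbours `u, v` are separated by `{a, b}` (`u` strictly inside one arc of the rim circle between `a` and `b`,
`v` strictly inside the other) — `a, b` lie in a common closed sector of the apex; it holds whenever `a, b, h` lie on a common face.
RESULTS, under (R)+(F)+(S): no `H`-connected `K ∋ a` is doubly linked to `{b, h}` (`Consts.Apex.unlinked_apexEnd`: the no-double-clash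
condition NDC at `(a; b, h)`), and no `H`-connected `K ∋ h` is doubly linked to `{a, b}` (`Consts.Apex.unlinked_apexRoot`: NDC at the
apex root); hence CSQ and DUU AT THE APEX ROOT with rim terminals `a, b` (`Consts.clusterSquare_le_sq_of_apexRoot`,
`Consts.sq_real_split_le_of_apexRoot`).  (S) is necessary for both combinatorial statements: rim 4-cycle, apex joined to two opposite
corners, `a, b` the two other corners — the clusters `{a}` and `{h}` are doubly linked.  The companion file
`…ConstsClusterSquareApexHubQuad.lean` shows that at a RIM root no sector condition is needed for the inequalities themselves: the
quadruple-clash criterion gives CSQ/DUU at `(a; b, h)` and TS for `{a, b, h}` for ALL rim `a, b` (double clashes occur, quadruple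
clashes do not); so (S) matters only for CSQ/DUU rooted at the apex, where quadruple clashes do occur without it (wheel `W₄` rooted at
the hub with `a, b` antipodal, gen 18).

THE PROOF (endgames in `…ConstsClusterSquareApexHubLinked.lean`).  Apex as terminal, root `a` on the rim: `h ∉ K`, the clash
vertices are rim vertices, the walks to `h` end with apex-neighbours `x₁, x₂`; the gap lemma cut open at `a` puts `b` strictly
between `x₁` and `x₂`, contradicting (S) (`Consts.Apex.false_of_linked_apexEnd`).  Apex as root: if `K` has a rim vertex `r`, the
rim endgame `Consts.Apex.false_of_linked_rim` applies verbatim with base point `r` (this case needs no sector condition); if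
`K = {h}` the clash vertices are apex-neighbours in a common arc cut out by `{a, b}` ((S)), so one linkage is interleaved
(`Consts.Apex.false_of_linked_apexOnly`).  Census (lane engine g21 `eng/apex_terminal.py`, exhaustive over the 73 472 (R)+(F)
graphs with ≤ 6 rim vertices): 0 doubly linked clusters in 9 545 160 + 4 488 192 rooted cases under (S); without (S) 41 298 resp.
11 685 violating cases (the latter all at `K = {h}`).
References: N. Gladkov, arXiv:2408.08457v2 (2024), Thm. 4.3, Def. 4.2, Lemma 3.1, Thm. 5.2 (two-copy vdBK behind
`…ClusterSquareUnlinked`); G. Chartrand, F. Harary, Ann. Inst. H. Poincaré B 3 (1967) 433–438 (outerplanar graphs).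
-/

noncomputable section

open Classical

namespace Summit.CriticalPhenomena.PercolationContinuityZ3.Theorems

open MeasureTheory Finset Literature.Probability.LatticeModels Literature.Probability.Percolation

namespace Consts

namespace Apex

variable {n m : ℕ}

/-! ### No double linkage when the apex is a terminal -/

/-- **No `H`-connected `K ∋ a` is doubly linked to `{b, h}` when `H` is an outerplanar rim graph plus one apex `h` inside a face,
`a, b` on the rim in a common sector of the apex** ((R), (F) and the sector condition (S) for `{a, b}`): the hypothesis `hK` of
`Consts.clusterSquare_le_sq_of_unlinked` holds at `(a; b, h)`. [folklore: Jordan curve theorem; cf. the planar common-face theorem of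
Gladkov2024, Thm. 6.1 (connection side, constant 2)] -/
theorem unlinked_apexEnd (H : SimpleGraph (Fin n)) (h : Fin n) (pos : Fin n → Fin m)
    (hpos : ∀ u v, u ≠ h → v ≠ h → pos u = pos v → u = v)
    (hR : ∀ p q r s : Fin n, p ≠ h → q ≠ h → r ≠ h → s ≠ h → H.Adj p q → H.Adj r s →
      pos p < pos r → pos r < pos q → pos q < pos s → False)
    (hF : ∀ p q u v : Fin n, p ≠ h → q ≠ h → H.Adj p q → H.Adj h u → H.Adj h v →
      pos p < pos u → pos u < pos q → (pos q < pos v ∨ pos v < pos p) → False)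
    {a b : Fin n} (ha : a ≠ h) (hb : b ≠ h)
    (hS : ∀ u v, H.Adj h u → H.Adj h v → ((pos a < pos u ∧ pos u < pos b) ∨ (pos b < pos u ∧ pos u < pos a)) →
      ((pos v < pos a ∧ pos v < pos b) ∨ (pos a < pos v ∧ pos b < pos v)) → False) :
    ∀ (K : Set (Fin n)) (y y' : Fin n), a ∈ K → b ∉ K → h ∉ K →
      (∀ T : Set (Fin n), a ∈ T → (∀ u x, u ∈ T → H.Adj u x → x ∈ K → x ∈ T) → K ⊆ T) →
      y ∉ K → y' ∉ K → (∃ k, k ∈ K ∧ H.Adj k y) → (∃ k, k ∈ K ∧ H.Adj k y') →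
      y ≠ a → y ≠ b → y ≠ h → y' ≠ a → y' ≠ b → y' ≠ h → y ≠ y' →
      (∀ (P₁ : H.Walk y b) (P₂ : H.Walk y' h), (∀ x ∈ P₁.support, x ∉ K) → (∀ x ∈ P₂.support, x ∉ K) →
          ∃ x, x ∈ P₁.support ∧ x ∈ P₂.support) ∨
      (∀ (Q₁ : H.Walk y h) (Q₂ : H.Walk y' b), (∀ x ∈ Q₁.support, x ∉ K) → (∀ x ∈ Q₂.support, x ∉ K) →
          ∃ x, x ∈ Q₁.support ∧ x ∈ Q₂.support) := by
  intro K y y' haK hbK hhK hcl hyK hy'K hky hk'y' _ hyb hyh _ hy'b hy'h hyy'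
  obtain ⟨G₀, H', g1, g2, g3, h12, h21⟩ := exists_rim_graphs H h pos hR hF
  have x1 : ∀ p q r s : Fin n, H'.Adj p q → G₀.Adj r s → (pos p - pos a).val < (pos r - pos a).val →
      (pos r - pos a).val < (pos q - pos a).val → (pos q - pos a).val < (pos s - pos a).val → False :=
    fun p q r s hpq hrs => noncross_rot₂ h12 h21 a hpq hrs
  have x2 : ∀ p q r s : Fin n, G₀.Adj p q → H'.Adj r s → (pos p - pos a).val < (pos r - pos a).val →
      (pos r - pos a).val < (pos q - pos a).val → (pos q - pos a).val < (pos s - pos a).val → False :=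
    fun p q r s hpq hrs => noncross_rot₂ h21 h12 a hpq hrs
  -- the sector condition cut open at `a`
  have hSa : ∀ u v, u ≠ a → H.Adj h u → H.Adj h v → (pos u - pos a).val < (pos b - pos a).val →
      (pos b - pos a).val < (pos v - pos a).val → False := by
    intro u v hua hu hv l1 l2
    have hu0 : (pos a - pos a).val < (pos u - pos a).val := by
      rw [NonCrossing.rot_self]
      refine Nat.pos_of_ne_zero fun e => hua (hpos u a (fun e' => hu.ne e'.symm) ha ?_)
      exact NonCrossing.rot_injective (pos a) (by rw [e, NonCrossing.rot_self])
    have hv0 : (pos a - pos a).val < (pos v - pos a).val := by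
      rw [NonCrossing.rot_self]; omega
    exact sector_rot hS a hu hv (Or.inl ⟨hu0, l1⟩) (Or.inr ⟨hv0, l2⟩)
  obtain ⟨k, hkK, hky⟩ := hky
  obtain ⟨k', hk'K, hk'y'⟩ := hk'y'
  by_contra hcon
  push Not at hcon
  obtain ⟨⟨P₁, P₂, hP₁, hP₂, hPd⟩, ⟨Q₁, Q₂, hQ₁, hQ₂, hQd⟩⟩ := hcon
  have hKw := NonCrossing.walks_of_closure haK hcl
  exact false_of_linked_apexEnd hpos g1 g2 g3 x1 x2 ha hKw hb hyh hy'h hkK hky hk'K hk'y' hyb hy'b hyy' hSa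
    P₁ P₂ hP₁ hP₂ hPd Q₁ Q₂ hQ₁ hQ₂ hQd

/-! ### No double linkage when the apex is the root -/

/-- **No `H`-connected `K ∋ h` is doubly linked to `{a, b}` when `H` is an outerplanar rim graph plus one apex `h` inside a face and
the rim terminals `a, b` lie in a common sector of the apex** ((R), (F), (S) for `{a, b}`): the hypothesis `hK` of
`Consts.clusterSquare_le_sq_of_unlinked` holds at `(h; a, b)`.  A cluster containing a rim vertex is handled by the rim endgame
`Consts.Apex.false_of_linked_rim` with that vertex as base point (no sector condition needed); `K = {h}` by
`Consts.Apex.false_of_linked_apexOnly`. [folklore: Jordan curve theorem] -/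
theorem unlinked_apexRoot (H : SimpleGraph (Fin n)) (h : Fin n) (pos : Fin n → Fin m)
    (hpos : ∀ u v, u ≠ h → v ≠ h → pos u = pos v → u = v)
    (hR : ∀ p q r s : Fin n, p ≠ h → q ≠ h → r ≠ h → s ≠ h → H.Adj p q → H.Adj r s →
      pos p < pos r → pos r < pos q → pos q < pos s → False)
    (hF : ∀ p q u v : Fin n, p ≠ h → q ≠ h → H.Adj p q → H.Adj h u → H.Adj h v →
      pos p < pos u → pos u < pos q → (pos q < pos v ∨ pos v < pos p) → False)
    {a b : Fin n} (ha : a ≠ h) (hb : b ≠ h)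
    (hS : ∀ u v, H.Adj h u → H.Adj h v → ((pos a < pos u ∧ pos u < pos b) ∨ (pos b < pos u ∧ pos u < pos a)) →
      ((pos v < pos a ∧ pos v < pos b) ∨ (pos a < pos v ∧ pos b < pos v)) → False) :
    ∀ (K : Set (Fin n)) (y y' : Fin n), h ∈ K → a ∉ K → b ∉ K →
      (∀ T : Set (Fin n), h ∈ T → (∀ u x, u ∈ T → H.Adj u x → x ∈ K → x ∈ T) → K ⊆ T) →
      y ∉ K → y' ∉ K → (∃ k, k ∈ K ∧ H.Adj k y) → (∃ k, k ∈ K ∧ H.Adj k y') →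
      y ≠ h → y ≠ a → y ≠ b → y' ≠ h → y' ≠ a → y' ≠ b → y ≠ y' →
      (∀ (P₁ : H.Walk y a) (P₂ : H.Walk y' b), (∀ x ∈ P₁.support, x ∉ K) → (∀ x ∈ P₂.support, x ∉ K) →
          ∃ x, x ∈ P₁.support ∧ x ∈ P₂.support) ∨
      (∀ (Q₁ : H.Walk y b) (Q₂ : H.Walk y' a), (∀ x ∈ Q₁.support, x ∉ K) → (∀ x ∈ Q₂.support, x ∉ K) →
          ∃ x, x ∈ Q₁.support ∧ x ∈ Q₂.support) := by
  intro K y y' hhK haK hbK hcl hyK hy'K hky hk'y' hyh hya hyb hy'h hy'a hy'b hyy'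
  obtain ⟨G₀, H', g1, g2, g3, h12, h21⟩ := exists_rim_graphs H h pos hR hF
  obtain ⟨k, hkK, hky⟩ := hky
  obtain ⟨k', hk'K, hk'y'⟩ := hk'y'
  by_contra hcon
  push Not at hcon
  obtain ⟨⟨P₁, P₂, hP₁, hP₂, hPd⟩, ⟨Q₁, Q₂, hQ₁, hQ₂, hQd⟩⟩ := hcon
  have hKw := NonCrossing.walks_of_closure hhK hcl
  have hab : a ≠ b := fun e => hPd a P₁.end_mem_support (e ▸ P₂.end_mem_support)
  by_cases hKr : ∃ r, r ∈ K ∧ r ≠ h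
  · -- a rim vertex `r ∈ K` as base point: the rim endgame
    obtain ⟨r, hrK, hrh⟩ := hKr
    have hKr : ∀ s ∈ K, ∃ W : H.Walk r s, ∀ v ∈ W.support, v ∈ K := by
      intro s hs
      obtain ⟨Wr, hWr⟩ := hKw r hrK
      obtain ⟨Ws, hWs⟩ := hKw s hs
      refine ⟨Wr.reverse.append Ws, fun v hv => ?_⟩
      rw [SimpleGraph.Walk.support_append, List.mem_append, SimpleGraph.Walk.support_reverse, List.mem_reverse] at hv
      rcases hv with hv | hv
      · exact hWr v hv
      · exact hWs v (List.mem_of_mem_tail hv)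
    have x1 : ∀ p q r' s : Fin n, H'.Adj p q → G₀.Adj r' s → (pos p - pos r).val < (pos r' - pos r).val →
        (pos r' - pos r).val < (pos q - pos r).val → (pos q - pos r).val < (pos s - pos r).val → False :=
      fun p q r' s hpq hrs => noncross_rot₂ h12 h21 r hpq hrs
    have x2 : ∀ p q r' s : Fin n, G₀.Adj p q → H'.Adj r' s → (pos p - pos r).val < (pos r' - pos r).val →
        (pos r' - pos r).val < (pos q - pos r).val → (pos q - pos r).val < (pos s - pos r).val → False :=
      fun p q r' s hpq hrs => noncross_rot₂ h21 h12 r hpq hrs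
    exact false_of_linked_rim hpos g1 g2 g3 x1 x2 hrh hKr ha hb hyh hy'h hkK hky hk'K hk'y' hya hyb hy'a hy'b hyy' hab
      P₁ P₂ hP₁ hP₂ hPd Q₁ Q₂ hQ₁ hQ₂ hQd
  · -- `K = {h}`: both clash vertices are apex-neighbours
    push Not at hKr
    have hk : k = h := hKr k hkK
    have hk' : k' = h := hKr k' hk'K
    rw [hk] at hky
    rw [hk'] at hk'y'
    exact false_of_linked_apexOnly hpos g1 g2 g3 h12 h21 ha hb hyh hy'h hky hk'y' hya hyb hy'a hy'b hab hS
      P₁ P₂ hPd Q₁ Q₂ hQd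

end Apex

/-! ### CSQ and DUU with the apex as the root (sector condition) -/

section Fin

variable {n m : ℕ} (w : Sym2 (Fin n) → unitInterval) (a b : Fin n) (H : SimpleGraph (Fin n)) (h : Fin n)
  (pos : Fin n → Fin m)

/-- **CSQ at the APEX as root, rim terminals `a, b` in a common sector** for an outerplanar rim graph plus one apex inside a face:
`clusterSquare w h a b ≤ μ(a ↮ b)²`. [cite: Gladkov2024, Thm. 4.3, Def. 4.2, Lemma 3.1, Thm. 5.2] -/
theorem clusterSquare_le_sq_of_apexRoot (hH : ∀ u v, u ≠ v → (0 : ℝ) < w s(u, v) → H.Adj u v)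
    (hpos : ∀ u v, u ≠ h → v ≠ h → pos u = pos v → u = v)
    (hR : ∀ p q r s : Fin n, p ≠ h → q ≠ h → r ≠ h → s ≠ h → H.Adj p q → H.Adj r s →
      pos p < pos r → pos r < pos q → pos q < pos s → False)
    (hF : ∀ p q u v : Fin n, p ≠ h → q ≠ h → H.Adj p q → H.Adj h u → H.Adj h v →
      pos p < pos u → pos u < pos q → (pos q < pos v ∨ pos v < pos p) → False)
    (ha : a ≠ h) (hb : b ≠ h)
    (hS : ∀ u v, H.Adj h u → H.Adj h v → ((pos a < pos u ∧ pos u < pos b) ∨ (pos b < pos u ∧ pos u < pos a)) →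
      ((pos v < pos a ∧ pos v < pos b) ∨ (pos a < pos v ∧ pos b < pos v)) → False) :
    clusterSquare w h a b ≤ (prodBernoulli w).real (openConn a b)ᶜ ^ 2 :=
  clusterSquare_le_sq_of_unlinked w h a b H hH (Apex.unlinked_apexRoot H h pos hpos hR hF ha hb hS)

/-- **DUU at the APEX as root, rim terminals `a, b` in a common sector** (same hypotheses):
`μ(h↮a, h↮b, a↮b)² ≤ μ(h↮a, h↮b) · μ(a↮b)²`. [cite: Gladkov2024, Thm. 5.2 and Thm. 4.3] -/
theorem sq_real_split_le_of_apexRoot (hH : ∀ u v, u ≠ v → (0 : ℝ) < w s(u, v) → H.Adj u v)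
    (hpos : ∀ u v, u ≠ h → v ≠ h → pos u = pos v → u = v)
    (hR : ∀ p q r s : Fin n, p ≠ h → q ≠ h → r ≠ h → s ≠ h → H.Adj p q → H.Adj r s →
      pos p < pos r → pos r < pos q → pos q < pos s → False)
    (hF : ∀ p q u v : Fin n, p ≠ h → q ≠ h → H.Adj p q → H.Adj h u → H.Adj h v →
      pos p < pos u → pos u < pos q → (pos q < pos v ∨ pos v < pos p) → False)
    (ha : a ≠ h) (hb : b ≠ h)
    (hS : ∀ u v, H.Adj h u → H.Adj h v → ((pos a < pos u ∧ pos u < pos b) ∨ (pos b < pos u ∧ pos u < pos a)) →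
      ((pos v < pos a ∧ pos v < pos b) ∨ (pos a < pos v ∧ pos b < pos v)) → False) :
    (prodBernoulli w).real ((openConn h a)ᶜ ∩ (openConn h b)ᶜ ∩ (openConn a b)ᶜ) ^ 2 ≤
      (prodBernoulli w).real ((openConn h a)ᶜ ∩ (openConn h b)ᶜ) * (prodBernoulli w).real (openConn a b)ᶜ ^ 2 :=
  sq_real_split_le_of_unlinked w h a b H hH (Apex.unlinked_apexRoot H h pos hpos hR hF ha hb hS)

end Fin

end Consts

end Summit.CriticalPhenomena.PercolationContinuityZ3.Theorems
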